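import Summits.QuantumFields.BalabanUV.T4Continuum.Support.NE7LevelMassesOfTower
import HarnessLib

/-!
# NE7MultiplierTermHierFrameFree — ON A HIERARCHICALLY FRAME-FREE LIFT THE LINEARISED TOWER IS THE STRAIGHT TOWER, AND (G3) CLOSES IN THE SCALE-CORRECT CURRENCY:
# `(∀ i ≤ m, Fbar (cavgIter i W) (dirIter i W Y) = 0) ⇒ dirIter i W Y = QbarIter i W Y` (pure algebra), the level masses contract `≤ 4(L²∕L^d)^i·dirSq Y`, and
# `|Dm(0)[D²𝒢_{m,W}(0)[ψ,ψ]]| ≤ 2curl1C·ε·K_C·(8·K_maj)·L²·(L^{−(m+1)})²·dirSq ψ̃` — ε × the SCALED fine mass, constant INDEPENDENT of m, j, N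
# (lineage `b2b-balaban-t4-ne7b-p1`, gen 162; ROAD-G116 §6 (G3) ∕ ROAD-G117 §4 (β); memo `t4/b2b-balaban-t4-ne7b-p1/g162/records/SCOPING-LEVELMASSES.md` §3)

Cell `pub-balaban`, rung (B)+1 sub-cell t4, lineage `b2b-balaban-t4-ne7b-p1` (row NE7b OWNER + CRUX PROVER; junction service for row NE7), generation 162.
WHY.  ✓ p834121 `multiplierTerm_le_levelMasses` reduces the multiplier term of the bordered Hessian to the level masses `dirSq (dirIter i W ψ̃)`; ✓ p835222 `NE7LevelMassesOfTower` shows these are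
`≤ C·(fine mass)` k-free but NOT scale-correctly so — the obstruction is the accumulated-frame part `gaugeDir (cavgIter i W) (framePotW i W Y)` of row NE3's structure theorem (sampled fine
frames do not contract; memo §2).  The road's slice of record (row NE3's FINE `(j+1)`-fold `frameFreeBlockLandauW`) kills only the TOTAL accumulated frame at the top sites; the representative
this lineage builds (route (H′): top-down over row NE3's ONE-level slices) kills the one-step frame AT EVERY LEVEL.  THIS FILE shows that the latter condition alone makes (G3) scale-correct.
WHAT ([folklore]; 0 def, 0 sorry):
§1 **`dirIter_eq_QbarIter_of_hierFrameFree`** (every `d`, every background, NO smallness — the split ✓ `cpush_eq_Qbar_add_gaugeDir` is an identity): if `Fbar L (cavgIter L i W) (dirIter L i W Y) = 0` for all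
   `i ≤ j`, then `dirIter L i W Y = QbarIter L i W Y` for all `i ≤ j + 1`;
§2 **`dirSq_dirIter_le_scaled_of_hierFrameFree`** (`3 ≤ d`, `2 ≤ L`, row NE3-R2's multi-level class): under the same hypothesis, for every level `i ≤ m+1` of one base,
   `dirSq (dirIter L i W Y) (periodBox (N·L^{m+1−i})) ≤ 4·(L²∕L^d)^i·dirSq Y (periodBox (N·L^{m+1}))` (✓ `NE3FramePotBoundWClass.l2sq_QbarIter_le_class`);
§3 **`multiplierTerm_le_scaledMass_of_hierFrameFree`** (`d = 4`, every `U(n)`, `L ≥ 2`; the frame of ✓ `multiplierTerm_le_levelMasses` verbatim plus the hypothesis that the lift `ψ̃` is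
   hierarchically frame-free at the base `W`): `|Dm(0)[D²𝒢_{m,W}(0)[ψ,ψ]]| ≤ 2·curl1C·ε·K_C·(K_maj·8)·L²·((L^{m+1})⁻¹)²·dirSq ψ̃ (periodBox (N·L^{m+1}))` — THE MULTIPLIER TERM IS `ε` TIMES THE
   SCALED FINE MASS OF THE LIFT, UNIFORMLY IN m, j, N (`Σ_{i≤m} (L∕L⁴)^{m−i}·4L^{−2i} ≤ 8·L^{−2m}`).
WHAT REMAINS FOR (G): a representative of every fibre element that is hierarchically frame-free (one-step frame-kill at every level: prescribed transported block means, row NE3's ✓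
`NE3CovariantBlockMean` lift, assembled over the depth-disjoint gauges of memo §3) TOGETHER with a fine-level scaled Poincaré `L^{−2(m+1)}·dirSq ≤ C·(curl energy + mass of v)` for it (route (H′):
row NE3's one-level (P♮)_W at every level + the Whitney-type lift ✓ `NE7WhitneyLiftFlat`∕`Average`∕`Defect`); the road's ✓ F7 `NE7HessDominatesCoarseCurl` and ✓ F9 apply to it verbatim (`frameComm = 0`).
HONEST FRAMING (page 1): composition of landed kernel theorems about OUR objects; nothing of Bałaban's asserted ([Balaban1985Averaging] (42), (110)–(125) context only); NOT (G), NOT NE7 as a spine node, NOT NE3;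
row NE7b NOT PRINTED ∕ NOT PROVED; spine 0∕9; finite T⁴ rung (B)+1 — NOT infinite volume, NOT mass gap, NOT BetaPertH, NOT Clay.
-/

set_option autoImplicit false

open scoped BigOperators Matrix Matrix.Norms.L2Operator Topology
open NormedSpace Finset Set Filter Metric

namespace Summit.QuantumFields.BalabanUV.T4Continuum.NE7MultiplierTermHierFrameFree

open Literature.MathematicalPhysics.QuantumFieldTheory.Balaban1983to89
open B7Prop1Explicit B7Prop2Explicit MatrixLog UnitaryModel
open T4AveragingDeficitWall (IsUnitaryCfg IsSkewDir SmallField Ad dirSq)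
open T4AveragingDeficitWallBoundary (IsPeriodicCfg periodBox)
open AveragingDeficitPeriodicCounting (IsPeriodicDir)
open AveragingDeficitTorusChart (TDir chart chartDir extDir isPeriodicDir_extDir)
open AveragingDeficitChartCalculus (cavg)
open AveragingDeficitMultiLevelPrep (tower cavgIter levelQ LevelSmall cpush)
open AveragingDeficitMultiLevelBridge (tower_eq)
open AveragingDeficitTwoLevelPrep (skewSub mem_skewSub twoLevelSmall)
open MinimalActionSandwich (IsMinimiser minAct)
open MinimalActionRate (sfClass)
open BlockAveragePushDirGauge (gaugeDir)
open NE3TangentCovariantStructure (Qbar Fbar cpush_eq_Qbar_add_gaugeDir)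
open NE3TangentCovariantTower (dirIter QbarIter dirIter_zero QbarIter_zero dirIter_succ QbarIter_succ cavgIter_succ)
open NE3CovariantLineSumsL2 (l2sq l2sq_nonneg)
open NE3FramePotBoundW (levelSmall_of_le)
open NE3FramePotBoundWClass (l2sq_QbarIter_le_class)
open NE3HatInvCurlLetters (curl1C curl1C_nonneg)
open BlockAverageVaryHolo (nbRad)
open BlockAverageVaryDisc (rho0)
open NE7MultiplierDensity (chartDir_id_eq_extDir)
open NE7MultiplierTermLevelMasses (multiplierTerm_le_levelMasses)
open NE7LevelMassesOfTower (dirSq_eq_l2sq)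

noncomputable section

variable {d : ℕ} {n : Type} [Fintype n] [DecidableEq n]

/-! ## §1 Hierarchical frame-freeness makes the linearised tower straight (pure algebra) -/

/-- `gaugeDir V 0 = 0`, pointwise. [folklore] -/
theorem gaugeDir_zero_apply (V : Site d → Fin d → (Matrix n n ℂ)ˣ) (z : Site d) (κ : Fin d) :
    gaugeDir V (fun _ => (0 : Matrix n n ℂ)) z κ = 0 := by
  simp [gaugeDir, Ad]

/-- **ON A HIERARCHICALLY FRAME-FREE DIRECTION THE LINEARISED TOWER IS THE STRAIGHT TOWER** (every `d`, every background, no smallness): if the one-step linearised frame of the level-`i`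
field vanishes for every `i ≤ j`, `Fbar L (cavgIter L i W) (dirIter L i W Y) = 0`, then `dirIter L i W Y = QbarIter L i W Y` for every `i ≤ j + 1`. [folklore] -/
theorem dirIter_eq_QbarIter_of_hierFrameFree (L : ℕ) :
    ∀ (j : ℕ) (W : Site d → Fin d → (Matrix n n ℂ)ˣ) (Y : Site d → Fin d → Matrix n n ℂ),
      (∀ i ≤ j, Fbar L (cavgIter L i W) (dirIter L i W Y) = fun _ => 0) →
      ∀ i ≤ j + 1, dirIter L i W Y = QbarIter L i W Y := by
  intro j
  induction j with
  | zero =>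
      intro W Y hff i hi
      interval_cases i
      · rfl
      · have h0 := hff 0 le_rfl
        rw [dirIter_zero] at h0
        funext z κ
        show dirIter L 1 W Y z κ = QbarIter L 1 W Y z κ
        rw [NE3TangentCovariantTower.dirIter_one, NE3TangentCovariantTower.QbarIter_one, cpush_eq_Qbar_add_gaugeDir,
          show cavgIter L 0 W = W from rfl] at *
        rw [h0, gaugeDir_zero_apply, add_zero]
  | succ j ih =>
      intro W Y hff i hi
      -- the bottom step is straight
      have h0 := hff 0 (Nat.zero_le _)
      rw [dirIter_zero] at h0
      have hstep : cpush L W Y = Qbar L W Y := by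
        funext z κ
        rw [cpush_eq_Qbar_add_gaugeDir, show cavgIter L 0 W = W from rfl] at *
        rw [h0, gaugeDir_zero_apply, add_zero]
      -- the remaining tower over the base `cavg W` with datum `cpush W Y = Qbar W Y`
      have hff' : ∀ i ≤ j, Fbar L (cavgIter L i (cavg L W)) (dirIter L i (cavg L W) (cpush L W Y)) = fun _ => 0 := by
        intro i hi'
        have h := hff (i + 1) (by omega)
        rw [cavgIter_succ, dirIter_succ] at h
        exact h
      rcases i with _ | i
      · rfl
      · rw [dirIter_succ, QbarIter_succ, ← hstep]
        exact ih (cavg L W) (cpush L W Y) hff' i (by omega)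

/-! ## §2 The level masses of a hierarchically frame-free direction contract scale-correctly -/

/-- **LEVEL MASSES OF A HIERARCHICALLY FRAME-FREE DIRECTION** (`2 ≤ L`, `1 ≤ N`; base `W` unitary `(N·L^{m+1})`-periodic with `0 ≤ x`, `LevelSmall d L m x`, `SmallField W x`; `Y` skew, periodic,
hierarchically frame-free up to level `m`): for every `i ≤ m+1`, `dirSq (dirIter L i W Y) (periodBox (N·L^{m+1−i})) ≤ 4·(L²∕L^d)^i·dirSq Y (periodBox (N·L^{m+1}))`. [folklore] -/
theorem dirSq_dirIter_le_scaled_of_hierFrameFree [Nonempty n] {L : ℕ} (hL : 2 ≤ L) {N : ℕ} (hN : 1 ≤ N) (m : ℕ)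
    {W : Site d → Fin d → (Matrix n n ℂ)ˣ} {x : ℝ} (hWu : IsUnitaryCfg W) (hWP : IsPeriodicCfg W ((N * L ^ (m + 1) : ℕ) : ℤ))
    (hx : 0 ≤ x) (hsm : LevelSmall d L m x) (hWx : SmallField W x)
    {Y : Site d → Fin d → Matrix n n ℂ} (hY : IsPeriodicDir Y ((N * L ^ (m + 1) : ℕ) : ℤ))
    (hff : ∀ i ≤ m, Fbar L (cavgIter L i W) (dirIter L i W Y) = fun _ => 0)
    {i : ℕ} (hi : i ≤ m + 1) :
    dirSq (dirIter L i W Y) (periodBox (d := d) (N * L ^ (m + 1 - i)))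
      ≤ 4 * ((L : ℝ) ^ 2 / (L : ℝ) ^ d) ^ i * dirSq Y (periodBox (d := d) (N * L ^ (m + 1))) := by
  rw [dirIter_eq_QbarIter_of_hierFrameFree L m W Y hff i hi, dirSq_eq_l2sq, dirSq_eq_l2sq]
  have hP : 1 ≤ N * L ^ (m + 1 - i) := Nat.one_le_iff_ne_zero.mpr (Nat.mul_ne_zero (by omega) (pow_ne_zero _ (by omega)))
  have hper : L ^ i * (N * L ^ (m + 1 - i)) = N * L ^ (m + 1) := by
    have him : i + (m + 1 - i) = m + 1 := by omega
    calc L ^ i * (N * L ^ (m + 1 - i)) = N * (L ^ i * L ^ (m + 1 - i)) := by ring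
      _ = N * L ^ (m + 1) := by rw [← pow_add, him]
  have hWP' : IsPeriodicCfg W ((L ^ i * (N * L ^ (m + 1 - i)) : ℕ) : ℤ) := by rw [hper]; exact hWP
  have hY' : IsPeriodicDir Y ((L ^ i * (N * L ^ (m + 1 - i)) : ℕ) : ℤ) := by rw [hper]; exact hY
  have h := l2sq_QbarIter_le_class (d := d) hL hP (j := m) i (by omega) hWu hWP' hx hsm hWx hY'
  rw [hper] at h
  exact h

/-! ## §3 (G3) in the scale-correct currency on hierarchically frame-free lifts -/

/-- **THE MULTIPLIER TERM OF THE BORDERED HESSIAN ON A HIERARCHICALLY FRAME-FREE LIFT IS `ε` TIMES THE SCALED FINE MASS** (`d = 4`, every `U(n)`, `L ≥ 2`; the frame of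
✓ `multiplierTerm_le_levelMasses` verbatim): `∃ ε₀ > 0 ∀ 0 < ε ≤ ε₀ ∀ N ≥ 1 ∃ δ_V > 0 ∀ j ∀ V₀` (unitary, `N`-periodic, `δ_V`-small) `∀ U♯` minimiser, for every `m`, every base `W` (unitary,
`(tower L N (m+1))`-periodic, `SmallField W x`, `0 ≤ x`, `LevelSmall 4 L m x`, `cavgIter L (m+1) W = V₀`) and every `ψ ∈ skewSub (L·tower L N m)` whose lift `ψ̃` is HIERARCHICALLY FRAME-FREE at `W`
(`∀ i ≤ m, Fbar L (cavgIter L i W) (dirIter L i W ψ̃) = 0`):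
`|Dm(0)[D²𝒢_{m,W}(0)[ψ,ψ]]| ≤ 2·curl1C·ε·K_C·(K_maj·8)·(L² · ((L^{m+1})⁻¹)²)·dirSq ψ̃ (periodBox (N·L^{m+1}))` — j-UNIFORM, SCALE-CORRECT. [folklore] -/
theorem multiplierTerm_le_scaledMass_of_hierFrameFree [Nonempty n] {L : ℕ} [NeZero L] (hL : 2 ≤ L) :
    ∃ ε₀ : ℝ, 0 < ε₀ ∧ ∀ ε : ℝ, 0 < ε → ε ≤ ε₀ → ∀ (N : ℕ) [NeZero N], 1 ≤ N → ∃ δV : ℝ, 0 < δV ∧ ∀ j : ℕ,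
        ∀ V₀ ∈ {V : Site 4 → Fin 4 → (Matrix n n ℂ)ˣ | IsUnitaryCfg V ∧ IsPeriodicCfg V (N : ℤ) ∧ SmallField V δV},
        ∀ Us : Site 4 → Fin 4 → (Matrix n n ℂ)ˣ, IsMinimiser 4 (sfClass 4 L N ε) L N (j + 1) V₀ Us →
        ∀ (m : ℕ) (W : Site 4 → Fin 4 → (Matrix n n ℂ)ˣ) (x : ℝ), IsUnitaryCfg W → IsPeriodicCfg W ((tower L N (m + 1) : ℕ) : ℤ) → 0 ≤ x →
          LevelSmall 4 L m x → SmallField W x → cavgIter L (m + 1) W = V₀ →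
        ∀ ψ : ↥(skewSub 4 n (L * tower L N m)),
          (∀ i ≤ m, Fbar L (cavgIter L i W) (dirIter L i W (chartDir (ContinuousLinearMap.id ℝ (Matrix n n ℂ)) (L * tower L N m) (ψ : TDir 4 n (L * tower L N m))))
              = fun _ => 0) →
          |fderiv ℝ (fun y : ↥(skewSub 4 n N) => minAct 4 (sfClass 4 L N ε) L N (j + 1) (chart (ContinuousLinearMap.id ℝ (Matrix n n ℂ)) N V₀ (y : TDir 4 n N))) 0
              (fderiv ℝ (fderiv ℝ (fun Φ : TDir 4 n (L * tower L N m) =>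
                levelQ L N m W (chart (ContinuousLinearMap.id ℝ (Matrix n n ℂ)) (L * tower L N m) W Φ))) 0
                (ψ : TDir 4 n (L * tower L N m)) (ψ : TDir 4 n (L * tower L N m)))|
            ≤ 2 * curl1C 4 L * ε * (4 / rho0 4 L ^ 2 * ((4 : ℕ) * (2 * nbRad 4 L + 1) ^ 4))
                * ((Real.exp (((L : ℝ) ^ 4 / L) * (((4 : ℕ) : ℝ) * (16 * (((4 : ℕ) : ℝ) + 1) * (((4 : ℕ) : ℝ) + 4) * (L : ℝ) ^ 2)
                        * (1250 * ((nbRad 4 L : ℝ) + L) + 8 * ((((4 : ℕ) : ℝ)) * L) + 2 * L)) * (2 / twoLevelSmall 4 L)) * 8)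
                    * ((L : ℝ) ^ 2 * (((L : ℝ) ^ (m + 1))⁻¹) ^ 2)
                    * dirSq (chartDir (ContinuousLinearMap.id ℝ (Matrix n n ℂ)) (L * tower L N m) (ψ : TDir 4 n (L * tower L N m)))
                        (periodBox (d := 4) (N * L ^ (m + 1)))) := by
  obtain ⟨ε₀, hε₀, H⟩ := multiplierTerm_le_levelMasses (n := n) hL
  have hL1 : 1 ≤ L := le_trans (by norm_num) hL
  refine ⟨ε₀, hε₀, fun ε hε hεle N _ hN => ?_⟩
  obtain ⟨δV, hδV, H1⟩ := H ε hε hεle N hN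
  refine ⟨δV, hδV, fun j V₀ hV₀ Us hUs m W x hWu hWP hx hs hWx htop ψ hff => ?_⟩
  have h := H1 j V₀ hV₀ Us hUs m W x hWu hWP hx hs hWx htop ψ
  refine h.trans ?_
  -- abbreviations
  set C : ℝ := 2 * curl1C 4 L * ε * (4 / rho0 4 L ^ 2 * ((4 : ℕ) * (2 * nbRad 4 L + 1) ^ 4)) with hC
  set K : ℝ := Real.exp (((L : ℝ) ^ 4 / L) * (((4 : ℕ) : ℝ) * (16 * (((4 : ℕ) : ℝ) + 1) * (((4 : ℕ) : ℝ) + 4) * (L : ℝ) ^ 2)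
      * (1250 * ((nbRad 4 L : ℝ) + L) + 8 * ((((4 : ℕ) : ℝ)) * L) + 2 * L)) * (2 / twoLevelSmall 4 L)) with hK
  set q : ℝ := (L : ℝ) / (L : ℝ) ^ 4 with hq
  set ψt : Site 4 → Fin 4 → Matrix n n ℂ := chartDir (ContinuousLinearMap.id ℝ (Matrix n n ℂ)) (L * tower L N m) (ψ : TDir 4 n (L * tower L N m)) with hψt
  set D : ℝ := dirSq ψt (periodBox (d := 4) (N * L ^ (m + 1))) with hD
  have hC0 : 0 ≤ C := by have := curl1C_nonneg 4 L; rw [hC]; positivity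
  have hK0 : 0 ≤ K := (Real.exp_pos _).le
  have hD0 : 0 ≤ D := by rw [hD]; unfold dirSq; exact Finset.sum_nonneg fun _ _ => Finset.sum_nonneg fun _ _ => sq_nonneg _
  have hL2 : (2 : ℝ) ≤ L := by exact_mod_cast hL
  have hL0 : (0 : ℝ) < L := by linarith
  -- the fine direction: periodic
  have hper : (L * tower L N m : ℕ) = N * L ^ (m + 1) := by rw [tower_eq]; ring
  have hψtP : IsPeriodicDir ψt ((N * L ^ (m + 1) : ℕ) : ℤ) := by
    rw [← hper, hψt, chartDir_id_eq_extDir]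
    haveI : NeZero (L * tower L N m) := ⟨by rw [hper]; exact Nat.mul_ne_zero (NeZero.ne N) (pow_ne_zero _ (NeZero.ne L))⟩
    exact isPeriodicDir_extDir (L * tower L N m) _
  have hWP' : IsPeriodicCfg W ((N * L ^ (m + 1) : ℕ) : ℤ) := by
    have e : (tower L N (m + 1) : ℕ) = N * L ^ (m + 1) := tower_eq L N (m + 1)
    rw [← e]; exact hWP
  -- each level: the straight-tower contraction `4·(L²∕L⁴)^i`
  have hρ : (L : ℝ) ^ 2 / (L : ℝ) ^ 4 = ((L : ℝ) ^ 2)⁻¹ := by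
    rw [show (L : ℝ) ^ 4 = (L : ℝ) ^ 2 * (L : ℝ) ^ 2 by ring, div_mul_eq_div_div, div_self (by positivity), one_div]
  have hlev : ∀ i ∈ Finset.range (m + 1), K * q ^ (m - i) * dirSq (dirIter L i W ψt) (periodBox (d := 4) (N * L ^ (m - i + 1)))
      ≤ K * (q ^ (m - i) * (4 * (((L : ℝ) ^ 2)⁻¹) ^ i)) * D := by
    intro i hi
    have him : i ≤ m := by have := Finset.mem_range.mp hi; omega
    have h1 := dirSq_dirIter_le_scaled_of_hierFrameFree (d := 4) hL hN m hWu hWP' hx hs hWx hψtP hff (i := i) (by omega)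
    have e : m + 1 - i = m - i + 1 := by omega
    rw [e, hρ] at h1
    have hq0 : 0 ≤ q ^ (m - i) := pow_nonneg (by rw [hq]; positivity) _
    calc K * q ^ (m - i) * dirSq (dirIter L i W ψt) (periodBox (d := 4) (N * L ^ (m - i + 1)))
        ≤ K * q ^ (m - i) * (4 * (((L : ℝ) ^ 2)⁻¹) ^ i * D) := mul_le_mul_of_nonneg_left h1 (mul_nonneg hK0 hq0)
      _ = K * (q ^ (m - i) * (4 * (((L : ℝ) ^ 2)⁻¹) ^ i)) * D := by ring
  -- the weighted geometric sum: `Σ_{i≤m} q^{m−i}·4·L^{−2i} ≤ 8·L^{−2m}` (`q = L^{−3}`, `Σ_k L^{−k} ≤ 2`)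
  have hqL : q = ((L : ℝ) ^ 3)⁻¹ := by
    rw [hq, show (L : ℝ) ^ 4 = L * (L : ℝ) ^ 3 by ring, div_mul_eq_div_div, div_self hL0.ne', one_div]
  have hgeom : ∑ i ∈ Finset.range (m + 1), q ^ (m - i) * (4 * (((L : ℝ) ^ 2)⁻¹) ^ i) ≤ 8 * (((L : ℝ) ^ 2)⁻¹) ^ m := by
    -- termwise: `q^{m-i}·L^{-2i} = L^{-2m}·L^{-(m-i)}`
    have hterm : ∀ i ∈ Finset.range (m + 1), q ^ (m - i) * (4 * (((L : ℝ) ^ 2)⁻¹) ^ i) = 4 * (((L : ℝ) ^ 2)⁻¹) ^ m * ((L : ℝ)⁻¹) ^ (m - i) := by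
      intro i hi
      have him : i ≤ m := by have := Finset.mem_range.mp hi; omega
      obtain ⟨k, rfl⟩ : ∃ k, m = i + k := ⟨m - i, by omega⟩
      rw [Nat.add_sub_cancel_left, hqL, pow_add]
      have hL3 : ((L : ℝ) ^ 3)⁻¹ = ((L : ℝ) ^ 2)⁻¹ * (L : ℝ)⁻¹ := by rw [← mul_inv, ← pow_succ]
      rw [hL3, mul_pow]
      ring
    rw [Finset.sum_congr rfl hterm, ← Finset.mul_sum]
    have hrefl : ∑ i ∈ Finset.range (m + 1), ((L : ℝ)⁻¹) ^ (m - i) = ∑ i ∈ Finset.range (m + 1), ((L : ℝ)⁻¹) ^ i := by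
      have h := Finset.sum_range_reflect (fun k => ((L : ℝ)⁻¹) ^ k) (m + 1)
      simpa using h
    rw [hrefl]
    have hg := NE3FramePotBound.geom_sum_le_inv (q := (L : ℝ)⁻¹) (by positivity) (by rw [inv_lt_one₀ hL0]; linarith) (m + 1)
    have hinv : 1 / (1 - (L : ℝ)⁻¹) ≤ 2 := by
      rw [div_le_iff₀ (by rw [sub_pos, inv_lt_one₀ hL0]; linarith)]
      have : (L : ℝ)⁻¹ ≤ 1 / 2 := by rw [inv_le_comm₀ hL0 (by norm_num)]; linarith
      linarith
    have h4 : 0 ≤ 4 * (((L : ℝ) ^ 2)⁻¹) ^ m := by positivity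
    calc 4 * (((L : ℝ) ^ 2)⁻¹) ^ m * ∑ i ∈ Finset.range (m + 1), ((L : ℝ)⁻¹) ^ i
        ≤ 4 * (((L : ℝ) ^ 2)⁻¹) ^ m * 2 := mul_le_mul_of_nonneg_left (hg.trans hinv) h4
      _ = 8 * (((L : ℝ) ^ 2)⁻¹) ^ m := by ring
  -- `8·L^{−2m} = 8·L²·(L^{m+1})^{−2}`
  have hscale : 8 * (((L : ℝ) ^ 2)⁻¹) ^ m = 8 * ((L : ℝ) ^ 2 * (((L : ℝ) ^ (m + 1))⁻¹) ^ 2) := by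
    congr 1
    rw [inv_pow, inv_pow, ← pow_mul, ← pow_mul]
    field_simp
    ring
  calc C * ∑ i ∈ Finset.range (m + 1), K * q ^ (m - i) * dirSq (dirIter L i W ψt) (periodBox (d := 4) (N * L ^ (m - i + 1)))
      ≤ C * ∑ i ∈ Finset.range (m + 1), K * (q ^ (m - i) * (4 * (((L : ℝ) ^ 2)⁻¹) ^ i)) * D := mul_le_mul_of_nonneg_left (Finset.sum_le_sum hlev) hC0
    _ = C * (K * D) * ∑ i ∈ Finset.range (m + 1), q ^ (m - i) * (4 * (((L : ℝ) ^ 2)⁻¹) ^ i) := by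
        rw [Finset.mul_sum, Finset.mul_sum]
        refine Finset.sum_congr rfl fun i _ => by ring
    _ ≤ C * (K * D) * (8 * (((L : ℝ) ^ 2)⁻¹) ^ m) := mul_le_mul_of_nonneg_left hgeom (by positivity)
    _ = C * ((K * 8) * ((L : ℝ) ^ 2 * (((L : ℝ) ^ (m + 1))⁻¹) ^ 2) * D) := by rw [hscale]; ring

end

end Summit.QuantumFields.BalabanUV.T4Continuum.NE7MultiplierTermHierFrameFree
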